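import Mathlib.Analysis.Fourier.ZMod
import Mathlib.NumberTheory.DirichletCharacter.GaussSum
import Mathlib.NumberTheory.LSeries.Linearity
import Literature.NumberTheory.EllipticCurves.ModularSymbols
import Literature.NumberTheory.EllipticCurves.CuspFormLFunctionProofs
import HarnessLib

/-!
# Modular symbols: Hecke's continuation of the translates, `L(f, 1)`, twists and Birch's formula

D-0014 keeps `Literature/` sorry-free by stating cited results as named facts `def X : Prop`.
This is the second discharge file of `Literature.NumberTheory.EllipticCurves.ModularSymbols`
(users holding `(h : X)` are fed `theorem X_holds : X`):

* the sibling `Literature.NumberTheory.EllipticCurves.ModularSymbolsProofs` proves the **Manin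
  calculus** (integrability of `t ↦ f(r + it)`, `{∞, r + n} = {∞, r}`, Manin's homomorphism and
  relations, `{∞, γ∞}_f = V_f(γτ) - V_{f|γ}(τ)`) by real-variable means;
* this file proves the facts that need the **entire continuation of `L`-series**:
  `{∞, 0}_f = L(f, 1)`, the continuation of the twisted `L`-series `L(f, χ, s)` and **Birch's
  formula**, all from Hecke's analytic continuation of `L`-series of cusp forms as set up in
  `Literature.NumberTheory.EllipticCurves.CuspFormLFunctionProofs` (Mellin transform along the
  imaginary axis, exponential decay at both ends), applied to the **translates**
  `f_q(τ) = f(τ + q)`, `q ∈ ℚ`, of `f ∈ S_2(Γ₀(N))`; and it reduces the Manin–Drinfeld rationality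
  fact `IsNewform0.exists_rat_smul_plusPeriod` to the three lattice facts.

The route:

* `translateCuspForm f q = f ∣[k] [1, q; 0, 1]` is a cusp form on the arithmetic subgroup
  `[1, -q; 0, 1] Γ [1, q; 0, 1]` (Mathlib `CuspForm.translate`, `Subgroup.IsArithmetic.conj`), whose
  cusp `∞` still has strict width `1` (`strictWidthInfty_conj_upperRightHom`) and whose
  `q`-expansion is `aₙ(f_q) = e^{2πinq} aₙ(f)` (`cuspCoeff_translateCuspForm`, by uniqueness of
  `q`-expansions, Mathlib `ModularFormClass.qExpansion_coeff_unique`);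
* hence (`heckeContinuation_translateCuspForm_eq`) Hecke's entire function
  `Λ_q(s) = (2π)^s Γ(s)⁻¹ ∫₀^∞ f(q + it) t^{s-1} dt` continues `L(f_q, s) = ∑ e^{2πinq} aₙ n⁻ˢ`
  (`re s > k/2 + 1`), and `Λ_q(1) = 2π ∫₀^∞ f(q + it) dt = {∞, q}_f` is the modular symbol
  (`modularSymbol_eq_heckeContinuation_translate`); in passing, `t ↦ f(q + it)` is integrable on
  `(0, ∞)` for every cusp form of any weight on any arithmetic subgroup
  (`integrableOn_translate_integrand`, Mellin convergence at `s = 1`).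

Discharged facts (`Literature.ModularForms.*_holds`):

* `modularSymbol_zero_eq` — `{∞, 0}_f = L(f, 1)` for every entire continuation `L` of `L(f, s)`
  (identity theorem: `L = Λ_0`; Manin 1972, Thm. 1.3);
* `exists_differentiable_eq_twistedLSeries` — `L(f, χ, s) = ∑ χ(n) aₙ n⁻ˢ` is continued by
  `m⁻¹ ∑_{a mod m} 𝓕χ(a) Λ_{a/m}(s)` for *every* Dirichlet character `χ` mod `m` (finite Fourier
  inversion `χ(n) = m⁻¹ ∑_a ψ(an) 𝓕χ(a)`, Mathlib `ZMod.dft`; Shimura 1971, Thm. 3.66);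
* `twisted_LValue_eq` — **Birch's formula** `τ(χ⁻¹) L(f, χ, 1) = ∑_a χ⁻¹(a) {∞, a/m}_f` for
  primitive `χ`: `∑_a χ⁻¹(a) Λ_{a/m}(s)` and `τ(χ⁻¹) L(s)` are entire and agree on `re s > 2` by
  `∑_a χ⁻¹(a) ψ(an) = χ(n) τ(χ⁻¹)` (Mathlib `gaussSum_mulShift_of_isPrimitive`), hence at `s = 1`
  (Birch 1971; Mazur–Tate–Teitelbaum 1986, §I.8, (8.6); Cremona §2.8, (2.8.3)–(2.8.6)).

Reduced fact: `IsNewform0.exists_rat_smul_plusPeriod_of` derives the Manin–Drinfeld rationality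
`re [r] ∈ ℚ · Ω⁺` from `isZLattice_periodLattice` (Eichler–Shimura), `conj_mem_periodLattice` and
`exists_nsmul_modularSymbol_mem_periodLattice` (Manin–Drinfeld) (Manin 1972, Cor. 3.6, Thm. 1.9).

Not treated here: the conjugation symmetry `{∞, -r} = conj {∞, r}` (`modularSymbol_neg_eq_conj`,
`plusSymbol_eq_re`, `minusSymbol_eq_im_mul_I`), Eichler–Shimura and Manin–Drinfeld themselves.

## References

* Ju. I. Manin, *Parabolic points and zeta functions of modular curves*, Izv. Akad. Nauk SSSR 36
  (1972), 19–66, §1.2–1.6, Thm. 1.3, Thm. 1.9, Cor. 3.6.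
* G. Shimura, *Introduction to the arithmetic theory of automorphic functions*, 1971, Prop. 3.64,
  Thm. 3.66.
* B. J. Birch, *Elliptic curves over `ℚ`: a progress report*, Proc. Sympos. Pure Math. 20 (1971).
* B. Mazur, J. Tate, J. Teitelbaum, *On `p`-adic analogues of the conjectures of Birch and
  Swinnerton-Dyer*, Invent. Math. 84 (1986), §I.8, (8.6).
* J. E. Cremona, *Algorithms for modular elliptic curves*, 2nd ed., CUP 1997, §2.1, §2.8, §2.10.
* E. Hecke, *Über die Bestimmung Dirichletscher Reihen durch ihre Funktionalgleichung*,
  Math. Ann. 112 (1936), 664–699.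
-/

noncomputable section

open scoped MatrixGroups ModularForm Manifold Real

open CongruenceSubgroup UpperHalfPlane Complex Filter Topology Asymptotics Set MeasureTheory
  Matrix.GeneralLinearGroup ConjAct Pointwise

namespace Literature.NumberTheory.EllipticCurves.ModularForms

/-! ### Translates `f(τ + x)` of cusp forms -/

section Translate

variable {Γ : Subgroup (GL (Fin 2) ℝ)} {k : ℤ}

/-- The translation `[1, x; 0, 1]` acts on `ℍ` by `τ ↦ τ + x`. [folklore] -/
theorem upperRightHom_smul (x : ℝ) (τ : ℍ) : upperRightHom x • τ = x +ᵥ τ := by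
  ext
  simp [σ, num, denom, coe_vadd, UpperHalfPlane.coe_smul, add_comm]

/-- The weight-`k` slash action of the translation `[1, x; 0, 1]` is `f ↦ (τ ↦ f(τ + x))`
(determinant `1`, automorphy factor `1`). [folklore] -/
theorem slash_upperRightHom_apply (f : ℍ → ℂ) (k : ℤ) (x : ℝ) (τ : ℍ) :
    (f ∣[k] upperRightHom x) τ = f (x +ᵥ τ) := by
  rw [ModularForm.slash_apply, upperRightHom_smul]
  simp [σ, denom, Matrix.GeneralLinearGroup.val_det_apply]

/-- Conjugating by a translation does not change the translations in a subgroup: the strict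
periods of `[1, -x; 0, 1] Γ [1, x; 0, 1]` are those of `Γ`. [folklore] -/
theorem strictPeriods_conj_upperRightHom (Γ : Subgroup (GL (Fin 2) ℝ)) (x : ℝ) :
    (toConjAct (upperRightHom x)⁻¹ • Γ).strictPeriods = Γ.strictPeriods := by
  ext y
  rw [Subgroup.mem_strictPeriods_iff, Subgroup.mem_strictPeriods_iff, map_inv,
    Subgroup.mem_inv_pointwise_smul_iff, toConjAct_smul, ← AddChar.map_neg_eq_inv,
    ← AddChar.map_add_eq_mul, ← AddChar.map_add_eq_mul, add_neg_cancel_comm]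

/-- Conjugating an arithmetic subgroup whose cusp `∞` has strict width `1` by a translation gives
a subgroup whose cusp `∞` has strict width `1` (same strict periods `ℤ`). [folklore] -/
theorem strictWidthInfty_conj_upperRightHom (Γ : Subgroup (GL (Fin 2) ℝ)) [Γ.IsArithmetic]
    (hΓ : Γ.strictWidthInfty = 1) (x : ℝ) :
    (toConjAct (upperRightHom x)⁻¹ • Γ).strictWidthInfty = 1 := by
  have hsp : (toConjAct (upperRightHom x)⁻¹ • Γ).strictPeriods = AddSubgroup.zmultiples 1 := by
    rw [strictPeriods_conj_upperRightHom, Subgroup.strictPeriods_eq_zmultiples_strictWidthInfty, hΓ]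
  have : DiscreteTopology (toConjAct (upperRightHom x)⁻¹ • Γ).strictPeriods := by
    rw [hsp]
    infer_instance
  rw [Subgroup.strictPeriods_eq_zmultiples_strictWidthInfty, Eq.comm,
    AddSubgroup.zmultiples_eq_zmultiples_iff
      (not_isOfFinAddOrder_of_isAddTorsionFree one_ne_zero)] at hsp
  rcases hsp with h | h
  · exact h.symm
  · linarith [(toConjAct (upperRightHom x)⁻¹ • Γ).strictWidthInfty_nonneg]

/-- The image of the rational translation `[1, q; 0, 1] ∈ GL(2, ℚ)` in `GL(2, ℝ)`. [folklore] -/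
theorem map_upperRightHom_ratCast (q : ℚ) :
    (upperRightHom q : GL (Fin 2) ℚ).map (Rat.castHom ℝ) = upperRightHom (q : ℝ) := by
  ext i j
  fin_cases i <;> fin_cases j <;> simp [upperRightHom_apply]

/-- Conjugates of an arithmetic subgroup by rational translations are arithmetic (Mathlib
`Subgroup.IsArithmetic.conj`). [folklore] -/
theorem isArithmetic_conj_upperRightHom (Γ : Subgroup (GL (Fin 2) ℝ)) [Γ.IsArithmetic] (q : ℚ) :
    (toConjAct (upperRightHom (q : ℝ) : GL (Fin 2) ℝ)⁻¹ • Γ).IsArithmetic := by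
  have h := Subgroup.IsArithmetic.conj Γ (upperRightHom q : GL (Fin 2) ℚ)⁻¹
  rwa [map_inv, map_upperRightHom_ratCast] at h

/-- The **translate** `f_q(τ) = f(τ + q)` of a cusp form `f` on `Γ` by a rational number `q`,
i.e. `f ∣[k] [1, q; 0, 1]`, as a cusp form on the arithmetic subgroup `[1, -q; 0, 1] Γ [1, q; 0, 1]`
(Mathlib `CuspForm.translate`) (Shimura 1971, Prop. 3.64, where `f(z + b/m)` is used to build the
twist `f_χ`). [folklore] -/
def translateCuspForm (f : CuspForm Γ k) (q : ℚ) :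
    CuspForm (toConjAct (upperRightHom (q : ℝ) : GL (Fin 2) ℝ)⁻¹ • Γ) k :=
  CuspForm.translate f (upperRightHom (q : ℝ))

/-- `f_q(τ) = f(q + τ)`. [folklore] -/
@[simp] theorem translateCuspForm_apply (f : CuspForm Γ k) (q : ℚ) (τ : ℍ) :
    translateCuspForm f q τ = f ((q : ℝ) +ᵥ τ) :=
  slash_upperRightHom_apply _ _ _ _

/-- The level `[1, -q; 0, 1] Γ [1, q; 0, 1]` of the translate `f_q` of a cusp form on an arithmetic
subgroup `Γ` is arithmetic (`isArithmetic_conj_upperRightHom`), registered as a (`Prop`-valued)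
instance so that the analytic lemmas of `CuspFormLFunctionProofs` apply to `translateCuspForm f q`.
[folklore] -/
instance isArithmetic_translate_level (Γ : Subgroup (GL (Fin 2) ℝ)) [Γ.IsArithmetic] (q : ℚ) :
    (toConjAct (upperRightHom ((q : ℝ)) : GL (Fin 2) ℝ)⁻¹ • Γ).IsArithmetic :=
  isArithmetic_conj_upperRightHom Γ q

/-- `𝕢₁(x + τ) = e^{2πix} 𝕢₁(τ)`. [folklore] -/
theorem qParam_vadd (x : ℝ) (τ : ℍ) :
    Function.Periodic.qParam 1 ((x +ᵥ τ : ℍ) : ℂ) =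
      Complex.exp (2 * π * Complex.I * x) * Function.Periodic.qParam 1 (τ : ℂ) := by
  rw [Function.Periodic.qParam, Function.Periodic.qParam, coe_vadd, ← Complex.exp_add]
  congr 1
  push_cast
  ring

/-- **`q`-expansion of the translate**: `aₙ(f_q) = e^{2πinq} aₙ(f)` when `1` is a strict period of
`Γ`: `f(q + τ) = ∑ aₙ e^{2πin(q + τ)}` and `q`-expansion coefficients are unique (Mathlib
`ModularFormClass.qExpansion_coeff_unique`) (Shimura 1971, proof of Prop. 3.64). [folklore] -/
theorem cuspCoeff_translateCuspForm (hΓ : (1 : ℝ) ∈ Γ.strictPeriods) (f : CuspForm Γ k) (q : ℚ)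
    (n : ℕ) :
    cuspCoeff (translateCuspForm f q) n =
      Complex.exp (2 * π * Complex.I * q * n) * cuspCoeff f n := by
  haveI : Fact (IsCusp OnePoint.infty Γ) := ⟨Γ.isCusp_of_mem_strictPeriods one_pos hΓ⟩
  have hΓ' : (1 : ℝ) ∈ (toConjAct (upperRightHom (q : ℝ) : GL (Fin 2) ℝ)⁻¹ • Γ).strictPeriods := by
    rwa [strictPeriods_conj_upperRightHom]
  have hsum : ∀ τ : ℍ,
      HasSum (fun m : ℕ ↦ (Complex.exp (2 * π * Complex.I * q * m) * cuspCoeff f m) •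
        Function.Periodic.qParam 1 (τ : ℂ) ^ m) (translateCuspForm f q τ) := by
    intro τ
    have h := UpperHalfPlane.hasSum_qExpansion one_pos
      (SlashInvariantFormClass.periodic_comp_ofComplex f hΓ) (ModularFormClass.holo f)
      (ModularFormClass.bdd_at_infty f) ((q : ℝ) +ᵥ τ)
    rw [translateCuspForm_apply]
    convert h using 2 with m
    rw [qParam_vadd, mul_pow, smul_eq_mul, smul_eq_mul, cuspCoeff, ← Complex.exp_nat_mul]
    push_cast
    ring_nf
  rw [cuspCoeff, ← ModularFormClass.qExpansion_coeff_unique one_pos hΓ' hsum n]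

end Translate

/-! ### Hecke's continuation for the translates and the modular-symbol integral -/

section HeckeTranslate

variable {Γ : Subgroup (GL (Fin 2) ℝ)} {k : ℤ} [Γ.IsArithmetic]

omit [Γ.IsArithmetic] in
/-- Along the imaginary axis the translate is the modular-symbol integrand:
`f_q(it) = f(q + it)` for `t > 0`. [folklore] -/
theorem imagAxis_translateCuspForm (f : CuspForm Γ k) (q : ℚ) {t : ℝ} (ht : 0 < t) :
    (fun t : ℝ ↦ translateCuspForm f q (ofComplex (Complex.I * t))) t =
      f (ofComplex ((q : ℂ) + t * Complex.I)) := by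
  have ht' : 0 < ((q : ℂ) + t * Complex.I).im := by simpa using ht
  rw [imagAxis_apply_of_pos _ ht, translateCuspForm_apply, ofComplex_apply_of_im_pos ht']
  congr 1
  ext1
  simp only [coe_vadd, Complex.ofReal_ratCast]
  ring

omit [Γ.IsArithmetic] in
/-- **Hecke's entire function of the translate at `s = 1` is the modular-symbol integral**:
`(2π)^s Γ(s)⁻¹ ∫₀^∞ f_q(it) t^{s-1} dt |_{s=1} = 2π ∫₀^∞ f(q + it) dt` (Manin 1972, Thm. 1.3
proof; Cremona §2.8, (2.8.3)). [folklore] -/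
theorem heckeContinuation_translateCuspForm_one (f : CuspForm Γ k) (q : ℚ) :
    (fun s ↦ (2 * Real.pi : ℂ) ^ s * (Complex.Gamma s)⁻¹ *
        mellin (fun t : ℝ ↦ translateCuspForm f q (ofComplex (Complex.I * t))) s) 1 =
      2 * Real.pi * ∫ t in Ioi (0 : ℝ), f (ofComplex ((q : ℂ) + t * Complex.I)) := by
  simp only [cpow_one, Complex.Gamma_one, inv_one, mul_one, mellin, sub_self, cpow_zero, one_smul]
  congr 1
  exact setIntegral_congr_fun measurableSet_Ioi fun t ht ↦ imagAxis_translateCuspForm f q ht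

/-- The modular-symbol integrand `t ↦ f(q + it)` is integrable on `(0, ∞)` for a cusp form on an
arithmetic subgroup and rational `q`: it is the restriction to the imaginary axis of the cusp form
`f_q` on `[1, -q; 0, 1] Γ [1, q; 0, 1]`, which decays exponentially at `∞` and rapidly at `0`
(Mathlib `mellinConvergent_of_isBigO_rpow_exp` at `s = 1`) (Manin 1972, §1.5; Cremona §2.10).
[folklore] -/
theorem integrableOn_translate_integrand (f : CuspForm Γ k) (q : ℚ) :
    IntegrableOn (fun t : ℝ ↦ f (ofComplex ((q : ℂ) + t * Complex.I))) (Ioi 0) := by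
  obtain ⟨c, hc, htop⟩ := exists_isBigO_imagAxis_atTop (translateCuspForm f q)
  have h : MellinConvergent (fun t : ℝ ↦ translateCuspForm f q (ofComplex (Complex.I * t))) 1 :=
    mellinConvergent_of_isBigO_rpow_exp hc
      ((continuousOn_imagAxis (CuspFormClass.holo _)).locallyIntegrableOn measurableSet_Ioi) htop
      (isBigO_imagAxis_nhdsGT_zero (translateCuspForm f q) 0) (by simp)
  rw [MellinConvergent] at h
  refine h.congr_fun (fun t ht ↦ ?_) measurableSet_Ioi
  dsimp only
  rw [sub_self, cpow_zero, one_smul]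
  exact imagAxis_translateCuspForm f q ht

/-- Two entire functions that agree on a right half-plane agree everywhere (identity theorem,
Mathlib `AnalyticOnNhd.eq_of_eventuallyEq`). [folklore] -/
theorem eq_of_forall_lt_re_eq {L L' : ℂ → ℂ} (hL : Differentiable ℂ L) (hL' : Differentiable ℂ L')
    (x : ℝ) (h : ∀ s : ℂ, x < s.re → L s = L' s) : L = L' := by
  refine AnalyticOnNhd.eq_of_eventuallyEq (hL.differentiableOn.analyticOnNhd isOpen_univ)
    (hL'.differentiableOn.analyticOnNhd isOpen_univ) (z₀ := ((x + 1 : ℝ) : ℂ)) ?_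
  have hopen : IsOpen {s : ℂ | x < s.re} := isOpen_lt continuous_const Complex.continuous_re
  filter_upwards [hopen.mem_nhds (show x < ((x + 1 : ℝ) : ℂ).re by simp)] with s hs
  exact h s hs

variable (hΓ : Γ.strictWidthInfty = 1)
include hΓ

omit [Γ.IsArithmetic] in
/-- The `L`-series of the translate is the additively twisted `L`-series
`L(f_q, s) = ∑ e^{2πinq} aₙ n⁻ˢ`. [folklore] -/
theorem cuspFormLSeries_translateCuspForm (f : CuspForm Γ k) (q : ℚ) (s : ℂ) :
    cuspFormLSeries (translateCuspForm f q) s =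
      LSeries (fun n ↦ Complex.exp (2 * π * Complex.I * q * n) * cuspCoeff f n) s := by
  have h1 : (1 : ℝ) ∈ Γ.strictPeriods := hΓ ▸ Γ.strictWidthInfty_mem_strictPeriods
  rw [cuspFormLSeries]
  congr 1
  funext n
  exact cuspCoeff_translateCuspForm h1 f q n

/-- **Hecke's continuation of the additively twisted `L`-series**: the entire function
`(2π)^s Γ(s)⁻¹ ∫₀^∞ f(q + it) t^{s-1} dt` equals `∑ e^{2πinq} aₙ n⁻ˢ` for `re s > k/2 + 1`
(`heckeContinuation_eq_cuspFormLSeries` for the cusp form `f_q`, whose level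
`[1, -q; 0, 1] Γ [1, q; 0, 1]` is arithmetic with cusp width `1` at `∞`) (Hecke 1936; Shimura 1971,
Thm. 3.66). [folklore] -/
theorem heckeContinuation_translateCuspForm_eq (f : CuspForm Γ k) (q : ℚ) {s : ℂ}
    (hs : (k : ℝ) / 2 + 1 < s.re) :
    (2 * Real.pi : ℂ) ^ s * (Complex.Gamma s)⁻¹ *
        mellin (fun t : ℝ ↦ translateCuspForm f q (ofComplex (Complex.I * t))) s =
      LSeries (fun n ↦ Complex.exp (2 * π * Complex.I * q * n) * cuspCoeff f n) s := by
  rw [← cuspFormLSeries_translateCuspForm hΓ,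
    heckeContinuation_eq_cuspFormLSeries (strictWidthInfty_conj_upperRightHom Γ hΓ q) _ hs]

/-- The additively twisted `L`-series `∑ e^{2πinq} aₙ n⁻ˢ` converges absolutely for
`re s > k/2 + 1` (it is `L(f_q, s)`; Hecke's bound). [folklore] -/
theorem LSeriesSummable_translate (f : CuspForm Γ k) (q : ℚ) {s : ℂ}
    (hs : (k : ℝ) / 2 + 1 < s.re) :
    LSeriesSummable (fun n ↦ Complex.exp (2 * π * Complex.I * q * n) * cuspCoeff f n) s := by
  have h1 : (1 : ℝ) ∈ Γ.strictPeriods := hΓ ▸ Γ.strictWidthInfty_mem_strictPeriods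
  have h := LSeriesSummable_cuspCoeff (strictWidthInfty_conj_upperRightHom Γ hΓ q)
    (translateCuspForm f q) hs
  exact h.congr' _ (Eventually.of_forall fun n ↦ cuspCoeff_translateCuspForm h1 f q n)

end HeckeTranslate

/-! ### `{∞, 0}_f = L(f, 1)` for `f ∈ S_2(Γ₀(N))` -/

section Gamma0

variable {N : ℕ} [NeZero N] (f : CuspForm (Gamma0 N) 2)

omit [NeZero N] in
/-- `{∞, q}_f` is the value at `s = 1` of Hecke's entire continuation of `L(f_q, s)`. [folklore] -/
theorem modularSymbol_eq_heckeContinuation_translate (q : ℚ) :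
    modularSymbol f q =
      (fun s ↦ (2 * Real.pi : ℂ) ^ s * (Complex.Gamma s)⁻¹ *
        mellin (fun t : ℝ ↦ translateCuspForm f q (ofComplex (Complex.I * t))) s) 1 := by
  rw [heckeContinuation_translateCuspForm_one, modularSymbol]

/-- Discharge of `modularSymbol_zero_eq`: **`{∞, 0}_f = L(f, 1)`** for every entire continuation
`L` of `L(f, s)`: `L` is Hecke's function `(2π)^s Γ(s)⁻¹ ∫₀^∞ f(it) t^{s-1} dt` (identity theorem),
whose value at `1` is `2π ∫₀^∞ f(it) dt` (Manin 1972, Thm. 1.3 proof; Cremona §2.8, (2.8.3)).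
[cite: Manin1972, Thm. 1.3 proof] -/
theorem modularSymbol_zero_eq_holds : modularSymbol_zero_eq f := by
  intro L hL hL'
  have hΓ := strictWidthInfty_Gamma0 N
  have heq : L = fun s ↦ (2 * Real.pi : ℂ) ^ s * (Complex.Gamma s)⁻¹ *
      mellin (fun t : ℝ ↦ translateCuspForm f 0 (ofComplex (Complex.I * t))) s := by
    refine eq_of_forall_lt_re_eq hL (differentiable_heckeContinuation _) 2 fun s hs ↦ ?_
    rw [hL' s hs, heckeContinuation_translateCuspForm_eq hΓ f 0 (by norm_num; exact hs),
      cuspFormLSeries]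
    simp
  rw [heq, ← modularSymbol_eq_heckeContinuation_translate]

end Gamma0

/-! ### Twisted `L`-series: Hecke–Shimura continuation and Birch's formula -/

section Twist

open scoped ZMod

variable {N : ℕ} [NeZero N] (f : CuspForm (Gamma0 N) 2) {m : ℕ} [NeZero m]

/-- **Hecke's entire continuation of `L(f_{a/m}, s) = ∑ e^{2πina/m} aₙ n⁻ˢ`**, `a mod m`:
`Λ_a(s) = (2π)^s Γ(s)⁻¹ ∫₀^∞ f(a/m + it) t^{s-1} dt` (Hecke 1936; Shimura 1971, Thm. 3.66;
Manin 1972, Thm. 1.3). [folklore] -/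
def heckeTranslate (a : ZMod m) (s : ℂ) : ℂ :=
  (2 * Real.pi : ℂ) ^ s * (Complex.Gamma s)⁻¹ *
    mellin (fun t : ℝ ↦ translateCuspForm f ((a.val : ℚ) / m) (ofComplex (Complex.I * t))) s

omit [NeZero m] in
/-- `Λ_a` is entire. [folklore] -/
theorem differentiable_heckeTranslate (a : ZMod m) : Differentiable ℂ (heckeTranslate f a) :=
  differentiable_heckeContinuation _

omit [NeZero N] [NeZero m] in
/-- `Λ_a(1) = {∞, a/m}_f`. [folklore] -/
theorem heckeTranslate_one (a : ZMod m) :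
    heckeTranslate f a 1 = modularSymbol f ((a.val : ℚ) / m) :=
  (modularSymbol_eq_heckeContinuation_translate f _).symm

omit [NeZero N] in
/-- `e^{2πi(a/m)n} = ψ(a n)` for the standard additive character `ψ(j) = e^{2πij/m}` of `ℤ/mℤ`
(Mathlib `ZMod.stdAddChar`). [folklore] -/
theorem stdAddChar_mul_natCast (a : ZMod m) (n : ℕ) :
    (ZMod.stdAddChar (a * (n : ZMod m)) : ℂ) =
      Complex.exp (2 * π * Complex.I * ((((a.val : ℚ) / m : ℚ)) : ℂ) * n) := by
  have h : (a * (n : ZMod m) : ZMod m) = ((a.val * n : ℤ) : ZMod m) := by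
    push_cast
    rw [ZMod.natCast_zmod_val]
  rw [h, ZMod.stdAddChar_coe]
  congr 1
  have hm : (m : ℂ) ≠ 0 := by exact_mod_cast NeZero.ne m
  push_cast
  field_simp

/-- `Λ_a(s) = ∑ ψ(an) aₙ n⁻ˢ` for `re s > 2` (Hecke; `heckeContinuation_translateCuspForm_eq`).
[folklore] -/
theorem heckeTranslate_eq (a : ZMod m) {s : ℂ} (hs : 2 < s.re) :
    heckeTranslate f a s =
      LSeries (fun n ↦ (ZMod.stdAddChar (a * (n : ZMod m)) : ℂ) * cuspCoeff f n) s := by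
  rw [heckeTranslate, heckeContinuation_translateCuspForm_eq (strictWidthInfty_Gamma0 N) f _
    (by push_cast; linarith)]
  congr 1
  funext n
  rw [stdAddChar_mul_natCast]

/-- `∑ ψ(an) aₙ n⁻ˢ` converges absolutely for `re s > 2`. [folklore] -/
theorem LSeriesSummable_stdAddChar_mul (a : ZMod m) {s : ℂ} (hs : 2 < s.re) :
    LSeriesSummable (fun n ↦ (ZMod.stdAddChar (a * (n : ZMod m)) : ℂ) * cuspCoeff f n) s := by
  have h := LSeriesSummable_translate (strictWidthInfty_Gamma0 N) f ((a.val : ℚ) / m)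
    (s := s) (by push_cast; linarith)
  refine (LSeriesSummable_congr s fun n ↦ ?_).mp h
  rw [stdAddChar_mul_natCast]

omit [NeZero N] in
/-- **Finite Fourier expansion of a function on `ℤ/mℤ` along `n ↦ ψ(an)`** (Fourier inversion,
Mathlib `ZMod.dft`): `Φ(n) = m⁻¹ ∑_a ψ(an) 𝓕Φ(a)`. [folklore] -/
theorem apply_natCast_eq_sum_dft (Φ : ZMod m → ℂ) (n : ℕ) :
    Φ n = (m : ℂ)⁻¹ * ∑ a : ZMod m, (ZMod.stdAddChar (a * (n : ZMod m)) : ℂ) * 𝓕 Φ a := by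
  have h := congr_fun (ZMod.dft.symm_apply_apply Φ) (n : ZMod m)
  rw [ZMod.invDFT_apply] at h
  simpa only [smul_eq_mul] using h.symm

/-- Discharge of `exists_differentiable_eq_twistedLSeries`: **the twisted `L`-series
`L(f, χ, s) = ∑ χ(n) aₙ n⁻ˢ` has an entire continuation** for every Dirichlet character `χ` mod
`m` (Shimura 1971, Prop. 3.64, Thm. 3.66; Hecke 1936), namely
`m⁻¹ ∑_{a mod m} 𝓕χ(a) Λ_a(s)`: expand `χ(n) = m⁻¹ ∑_a ψ(an) 𝓕χ(a)` (finite Fourier inversion) and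
use Hecke's continuation `Λ_a` of `∑ ψ(an) aₙ n⁻ˢ = L(f_{a/m}, s)`.
[cite: Shimura1971, Thm. 3.66] -/
theorem exists_differentiable_eq_twistedLSeries_holds :
    exists_differentiable_eq_twistedLSeries f (m := m) := by
  intro χ
  refine ⟨fun s ↦ (m : ℂ)⁻¹ * ∑ a : ZMod m, 𝓕 (⇑χ) a * heckeTranslate f a s, ?_, ?_⟩
  · exact (Differentiable.fun_sum fun a _ ↦
      (differentiable_heckeTranslate f a).const_mul _).const_mul _
  · intro s hs
    have hfun : (fun n : ℕ ↦ χ n * cuspCoeff f n) =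
        ∑ a : ZMod m, ((m : ℂ)⁻¹ * 𝓕 (⇑χ) a) •
          (fun n : ℕ ↦ (ZMod.stdAddChar (a * (n : ZMod m)) : ℂ) * cuspCoeff f n) := by
      funext n
      rw [apply_natCast_eq_sum_dft (⇑χ) n]
      simp only [Finset.sum_apply, Pi.smul_apply, smul_eq_mul, Finset.mul_sum, Finset.sum_mul]
      refine Finset.sum_congr rfl fun a _ ↦ ?_
      ring
    rw [twistedLSeries, hfun,
      LSeries_sum (fun a _ ↦ (LSeriesSummable_stdAddChar_mul f a hs).smul _)]
    dsimp only
    rw [Finset.mul_sum]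
    refine Finset.sum_congr rfl fun a _ ↦ ?_
    rw [LSeries_smul, heckeTranslate_eq f a hs, mul_assoc]

omit [NeZero N] in
/-- **The Gauss-sum identity behind Birch's formula**: for a primitive `χ` mod `m` and every
`n`, `∑_a χ⁻¹(a) ψ(an) = χ(n) τ(χ⁻¹)` (Mathlib `gaussSum_mulShift_of_isPrimitive`; both sides
vanish when `gcd(n, m) > 1`). [folklore] -/
theorem sum_inv_mul_stdAddChar_eq {χ : DirichletCharacter ℂ m} (hχ : χ.IsPrimitive) (n : ℕ) :
    ∑ a : ZMod m, χ⁻¹ a * (ZMod.stdAddChar (a * (n : ZMod m)) : ℂ) =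
      χ n * gaussSum χ⁻¹ (ZMod.stdAddChar (N := m)) := by
  have hχ' : χ⁻¹.IsPrimitive := by
    rw [DirichletCharacter.isPrimitive_def, DirichletCharacter.conductor_inv]
    exact hχ
  have h := gaussSum_mulShift_of_isPrimitive (ZMod.stdAddChar (N := m)) hχ' (n : ZMod m)
  rw [inv_inv, gaussSum] at h
  rw [← h]
  refine Finset.sum_congr rfl fun a _ ↦ ?_
  rw [AddChar.mulShift_apply, mul_comm (n : ZMod m) a]

/-- Discharge of `twisted_LValue_eq`: **Birch's formula**
`τ(χ⁻¹) L(f, χ, 1) = ∑_a χ⁻¹(a) {∞, a/m}_f` for a primitive `χ` mod `m` and the entire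
continuation `L` of `L(f, χ, s)` (Birch 1971;
Mazur–Tate–Teitelbaum 1986, §I.8, (8.6); Cremona §2.8). Proof: the entire functions
`∑_a χ⁻¹(a) Λ_a(s)` and `τ(χ⁻¹) L(s)` agree on `re s > 2`, since
`∑_a χ⁻¹(a) ∑_n ψ(an) aₙ n⁻ˢ = ∑_n (∑_a χ⁻¹(a) ψ(an)) aₙ n⁻ˢ = τ(χ⁻¹) ∑_n χ(n) aₙ n⁻ˢ`; hence
everywhere, and at `s = 1` the left side is `∑_a χ⁻¹(a) {∞, a/m}_f` (`Λ_a(1) = {∞, a/m}_f`).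
[cite: Birch1971] -/
theorem twisted_LValue_eq_holds : twisted_LValue_eq f (m := m) := by
  intro χ hχ L hL hL'
  set G : ℂ → ℂ := fun s ↦ ∑ a : ZMod m, χ⁻¹ a * heckeTranslate f a s with hG
  have hGd : Differentiable ℂ G :=
    Differentiable.fun_sum fun a _ ↦ (differentiable_heckeTranslate f a).const_mul _
  have hagree : ∀ s : ℂ, 2 < s.re →
      G s = gaussSum χ⁻¹ (ZMod.stdAddChar (N := m)) * L s := by
    intro s hs
    have hfun : (gaussSum χ⁻¹ (ZMod.stdAddChar (N := m))) • (fun n : ℕ ↦ χ n * cuspCoeff f n) =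
        ∑ a : ZMod m, (χ⁻¹ a) •
          (fun n : ℕ ↦ (ZMod.stdAddChar (a * (n : ZMod m)) : ℂ) * cuspCoeff f n) := by
      funext n
      simp only [Finset.sum_apply, Pi.smul_apply, smul_eq_mul]
      rw [show gaussSum χ⁻¹ (ZMod.stdAddChar (N := m)) * (χ n * cuspCoeff f n) =
        (χ n * gaussSum χ⁻¹ (ZMod.stdAddChar (N := m))) * cuspCoeff f n by ring,
        ← sum_inv_mul_stdAddChar_eq hχ n, Finset.sum_mul]
      refine Finset.sum_congr rfl fun a _ ↦ ?_
      ring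
    rw [hL' s hs, twistedLSeries, ← LSeries_smul, hfun,
      LSeries_sum (fun a _ ↦ (LSeriesSummable_stdAddChar_mul f a hs).smul _)]
    refine Finset.sum_congr rfl fun a _ ↦ ?_
    rw [LSeries_smul, heckeTranslate_eq f a hs]
  have heq := eq_of_forall_lt_re_eq hGd (hL.const_mul _) 2 hagree
  have h1 := congr_fun heq 1
  simp only [hG, heckeTranslate_one] at h1
  rw [← h1, twistedSymbolSum]

end Twist

/-! ### Manin–Drinfeld rationality of `[r]⁺` from the lattice facts -/

section Rationality

variable {N : ℕ} [NeZero N] {f : CuspForm (Gamma0 N) 2}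

omit [NeZero N] in
/-- If `n • z ∈ Λ_f` with `n > 0` and `re Λ_f = ℤ · (Ω/2)`, then `re z ∈ ℚ · Ω`. [folklore] -/
theorem exists_rat_re_eq_of_nsmul_mem {Ω : ℝ} (hΩ : realPeriods f = AddSubgroup.zmultiples (Ω / 2))
    {z : ℂ} {n : ℕ} (hn : 0 < n) (hz : n • z ∈ periodLattice f) :
    ∃ q : ℚ, z.re = q * Ω := by
  have hre : (n • z).re ∈ realPeriods f := AddSubgroup.mem_map_of_mem _ hz
  rw [hΩ, AddSubgroup.mem_zmultiples_iff] at hre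
  obtain ⟨k, hk⟩ := hre
  refine ⟨(k : ℚ) / (2 * n), ?_⟩
  have hn' : (n : ℝ) ≠ 0 := by exact_mod_cast hn.ne'
  rw [Complex.re_nsmul, nsmul_eq_mul, zsmul_eq_mul] at hk
  push_cast
  field_simp
  linarith

/-- **Manin–Drinfeld rationality of `[r]⁺` from the lattice facts**: the named fact
`IsNewform0.exists_rat_smul_plusPeriod` (`Ω⁺_f ≠ 0` and `re (plusSymbol f r) ∈ ℚ · Ω⁺_f`) follows
from the named facts `isZLattice_periodLattice` (Eichler–Shimura: `Λ_f` is a lattice),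
`conj_mem_periodLattice` (`Λ̄_f = Λ_f`; together they give `re Λ_f = ℤ · Ω⁺/2` with `Ω⁺ > 0`,
`exists_pos_map_re_eq_zmultiples`) and the Manin–Drinfeld theorem
`exists_nsmul_modularSymbol_mem_periodLattice` (`n {∞, r} ∈ Λ_f` for some `n > 0`), since then
`re {∞, ±r} ∈ ℚ · Ω⁺` (Manin 1972, Cor. 3.6 with Thm. 1.9; Drinfeld 1973; Cremona §2.8;
Mazur–Tate–Teitelbaum 1986, §I.8). [cite: Manin1972, Cor. 3.6 with Thm. 1.9] -/
theorem IsNewform0.exists_rat_smul_plusPeriod_of (H₁ : isZLattice_periodLattice (f := f))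
    (H₂ : conj_mem_periodLattice (f := f))
    (H₃ : exists_nsmul_modularSymbol_mem_periodLattice f) :
    IsNewform0.exists_rat_smul_plusPeriod (f := f) := by
  intro hf hQ
  obtain ⟨_, hlat⟩ := H₁ hf hQ
  have h : ∃ Ω : ℝ, 0 < Ω ∧ realPeriods f = AddSubgroup.zmultiples (Ω / 2) :=
    exists_pos_map_re_eq_zmultiples hlat (fun _ hz ↦ H₂ hf hQ hz)
  have hΩ : plusPeriod f = h.choose := by simp only [plusPeriod, dif_pos h]
  have hpos : 0 < plusPeriod f := hΩ ▸ h.choose_spec.1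
  have hre : realPeriods f = AddSubgroup.zmultiples (plusPeriod f / 2) := hΩ ▸ h.choose_spec.2
  refine ⟨hpos.ne', fun r ↦ ?_⟩
  obtain ⟨n, hn, hnr⟩ := H₃ r
  obtain ⟨n', hn', hnr'⟩ := H₃ (-r)
  obtain ⟨q, hq⟩ := exists_rat_re_eq_of_nsmul_mem hre hn hnr
  obtain ⟨q', hq'⟩ := exists_rat_re_eq_of_nsmul_mem hre hn' hnr'
  refine ⟨(q + q') / 2, ?_⟩
  rw [plusSymbol, Complex.div_re, Rat.smul_def]
  simp only [Complex.add_re, hq, hq', Complex.normSq_ofNat, Complex.re_ofNat, Complex.add_im,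
    Complex.im_ofNat, mul_zero, zero_div, add_zero]
  push_cast
  ring

end Rationality

end Literature.NumberTheory.EllipticCurves.ModularForms
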